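import Summits.ABC.IUTFork.LDHGenuine
import Summits.ABC.IUTFork.LDHTensorHoffCompletions
import HarnessLib

/-!
# The fork at [IUTchIII] Corollary 3.12, L-DH level: the finite support of the genuine `−|log(Θ)|` is immaterial
# (route D3, part h: `supportPrimes` IS Dupuy–Hilado's `Σ_p`)

Record-only file (D-0012) of the abc-iut cell (campaign-S seat abc-iut-S2); TAKES NO SIDE. Dupuy–Hilado,
arXiv:2004.13228 §1 p. 4 / Def. 3.6.3: `ln ν̄_𝕃(B) = Σ_p ln ν̄_{𝕃_p}(B_p)` over ALL primes; [IUTchIV] Thm. 1.10 Step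
(vi) (kurims p. 29): at `v ∉ 𝕍^dst` (odd residue characteristic, `K` unramified) the summand vanishes.

abc-iut-S2's Literature-level `ThetaVolumeInput.negLogThetaNonarch I` sums over the CANONICAL finite set
`T(I) = (2·|disc K|).primeFactors ∪ char(S)` (`supportPrimes`). Using abc-iut-c312-3's hypothesis-free stabilisation
over the genuine completions (`LDHTensorHoffCompletions.negLogThetaDHOn_ofIdelesM_completions_eq`, from
`realPrimePacketM_shell_eq_O` + Dedekind's discriminant theorem `CompletionLocalFieldsUnramified`) through the bridge
`DHData.ofInput` (`LDHGenuine`), this file records that the choice of `T(I)` is IMMATERIAL: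
* `negLogThetaDHOn_ofInput_eq` — for every finite set of primes `T' ⊇ T(I)`:
  `ln ν̄_{𝕃,T'}(hull(U_Θ)) = negLogThetaNonarch I` (all further summands are `0`);
* `cor312DHLim_ofInput_iff` — Dupuy–Hilado's (1.1) WITH `Σ_p` OVER ALL PRIMES (c312-3's `Cor312DHLim`) for the datum
  of `I` ⟺ the Literature-level nonarchimedean form `Cor312NonarchOf I`; hence (`cor312Of_of_cor312DHLim`) it
  implies [IUTchIII]'s form `Cor312Of I`.
[cite: DupuyHilado2025, §1 p. 4, Def. 3.6.3] [cite: Mochizuki2012, IUTchIV Thm 1.10 proof Step (vi) p.29]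
[claim: Mochizuki2012, status: disputed] HYPOTHESES on both sides of every `↔`; nothing asserted.
-/

noncomputable section

namespace Summit.ABC.IUTFork

namespace DHData

open Literature.IUT.LogVolume NumberField IsDedekindDomain

variable {F₀ K : Type} [Field F₀] [NumberField F₀] [Field K] [NumberField K] [Algebra F₀ K]
  (I : ThetaVolumeInput F₀ K)

/-- **The support is immaterial**: for every finite set of primes `T' ⊇ T(I)`, the truncated `ln ν̄_{𝕃,T'}(hull(U_Θ))`
of the datum of `I` equals `negLogThetaNonarch I` (the summands at `p ∉ T(I)` vanish: `p` odd, `K` unramified at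
`p`, no pilot). [cite: Mochizuki2012, IUTchIV Thm 1.10 proof Step (vi) p.29] -/
theorem negLogThetaDHOn_ofInput_eq {T' : Finset ℕ} (h : I.supportPrimes ⊆ T') (hT' : ∀ p ∈ T', p.Prime) :
    (ofInput I).negLogThetaDHOn T' = I.negLogThetaNonarch := by
  rw [← negLogThetaDH_ofInput, ← negLogThetaDHOn_self]
  exact negLogThetaDHOn_ofIdelesM_completions_eq I.σ I.X I.tΘ I.tΘ_ord I.tq I.tq_ord I.supportPrimes
    (fun _ hp => I.prime_of_mem_supportPrimes hp) (fun _ hv => I.residueChar_mem_supportPrimes hv)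
    I.supportPrimes (fun _ hv => I.residueChar_mem_supportPrimes hv) Finset.subset_union_left h hT'

/-- **Dupuy–Hilado's (1.1) with `Σ_p` over ALL primes ⟺ the Literature-level nonarchimedean form** for the datum of a
genuine input (`Cor312DHLim ↔ Cor312DH` over the genuine completions, c312-3; `Cor312DH ↔ Cor312NonarchOf`, S2).
[claim: Mochizuki2012, status: disputed] -/
theorem cor312DHLim_ofInput_iff : (ofInput I).Cor312DHLim ↔ I.Cor312NonarchOf := by
  rw [← cor312DH_ofInput_iff]
  exact cor312DHLim_ofIdelesM_completions_iff_cor312DH I.σ I.X I.tΘ I.tΘ_ord I.tq I.tq_ord I.supportPrimes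
    (fun _ hp => I.prime_of_mem_supportPrimes hp) (fun _ hv => I.residueChar_mem_supportPrimes hv)
    Finset.subset_union_left

/-- Hence (1.1) with `Σ_p` over all primes implies [IUTchIII]'s form `Cor312Of I` (archimedean summand added).
[claim: Mochizuki2012, status: disputed] -/
theorem cor312Of_of_cor312DHLim (h : (ofInput I).Cor312DHLim) : I.Cor312Of :=
  I.cor312Of_of_cor312NonarchOf ((cor312DHLim_ofInput_iff I).mp h)

end DHData

end Summit.ABC.IUTFork

end
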